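import Summits.QuantumFields.BalabanUV.Beta.GAN24.ContactRefineBThree
import Summits.QuantumFields.BalabanUV.Beta.GAN24.ContactGaugeRefine
import Summits.QuantumFields.BalabanUV.Beta.GAN24.RespStepRefine
import Summits.QuantumFields.BalabanUV.Beta.GAN24.ContactTentRefine
import Summits.QuantumFields.BalabanUV.Beta.GAN24.ContactAssembly
import Summits.QuantumFields.BalabanUV.Beta.GAN24.StaircaseFaceDensity

/-!
# `BalabanUV.Beta.GAN24.ContactRefineBHolds` — binder row G-an2-4 / (CONV-C), the row owner's CONTACT-TERM ROUTE, **CT-4c-B at `d = 3`, THE WRAPPER**: the five letter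
# families of `ContactRefineBThree` DISCHARGED by their suppliers at ONE common rate, and the three B-atom two-tower differences in CLOSED GEOMETRIC FORM
# `K·ϑ^k·Zl·e^{−(κ∕12)·spread}`, `ϑ < 1`, from `2 ≤ Lc` ALONE.

NOT IN PRINT; OUR BOOKKEEPING (G-an2-4 formalisation swarm, leaf prover `b2b-balaban-gan24-formalise-leaf-02`, gen 50; INTENT «CT-4c-B THREE» journal `CLAIMS.log`
l.35669 ∕ l.35757).  HONEST FRAMING (cell contract, verbatim): «discharging `BetaPertH` makes Bałaban's UV stability UNCONDITIONAL — a real constructive-QFT result;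
it is NOT the continuum limit and NOT the Clay problem.»  HONEST DEPENDENCY (verbatim): «continuum YM on T⁴ ⇐ BetaPertH ∧ nine spine estimates (0/9 proved);
BetaPertH ⇐ (D1) ∧ (D4) ∧ CAP+tail; G-an2-4 gates asym, D1 and NE2/3/4.»

WHAT (`d = 3`, `2 ≤ Lc`; 0 `def`, 0 cited fact, 0 `def … : Prop`, 0 sorry; [folklore] bookkeeping BY NAME).
* §1 **`exists_common_refine_letters_three`** — ONE rate `κ > 0` and constants for the five families `ContactRefineBThree` is parametric in: (N1) (leaf-01 g58's
  `ContactAssembly.exists_common_letters` (a), leaf-12), the tent bound ((d) ibid., d4-p3's I1), ε₁ (leaf-01 g61's `RespStepRefine.exists_respStep_refine`, the T-N1C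
  team's block-sample Cauchy letter), ε₃ (gan24-p2 g32's `ContactTentRefine.exists_tent_refine_three`, the K-slot's all-scales letter; its `A, B` replaced by `|A|, |B|`),
  εψ (leaf-01 g61's `ContactGaugeRefine.exists_gauge_refine_site_three` over p2 g34's CT-4b) — every envelope weakened to the minimum rate (p2's `exp_env_mono`), the two
  (N1) constants merged by `max`.
* §2 `exists_geometric_majorant` — `θ₁^k, θt^k, θ^k, (Lc^{k+1})⁻¹ ≤ ϑ^k` and `(k+1)·(Lc^{k+1})⁻¹ ≤ Kρ·ϑ^k` for ONE `ϑ < 1` (leaf-03 g52's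
  `StaircaseFaceDensity.succ_pow_mul_pow_le_mul_pow` absorbs the log of CT4-DESIGN §2 (δ)).
* §3 **`exists_atomTip_refine_three`**, **`exists_atomMid_refine_three`**, **`exists_atomSite_refine_three`**: `∃ κ K ϑ, 0 < κ ∧ 0 ≤ K ∧ 0 ≤ ϑ ∧ ϑ < 1 ∧` for every in-block root,
  every `k` and all cell data `(κ′,u′) (α,x′) (β,z′)`, `|N′^{12}·atom_{k+1} − N^{12}·atom_k| ≤ K·ϑ^k·Zl 4 (κ∕16)·e^{−(κ∕12)(‖u′−x′‖∞+‖z′−x′‖∞)}` — the B-atoms of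
  «CT-3c with one slot differenced» at SOME rate `ϑ < 1` (the consumer's `θS` is free in `FP.RoadLeftAssemblyRows.d1Drift_left_of_sliceLedger_rows`, refuter CHECK #60 (i)).
Discharges NOTHING of hSdev by itself (CT-4e: + p2's P-atoms + the per-cell signed combination + road S3's undressed rows); 0 wall binders; NEVER «G-an2-4 closed» as
(CONV-C); NOT D1, NOT BetaPertH, NOT continuum, NOT Clay.
-/

noncomputable section

open Finset
open scoped BigOperators
open Literature.MathematicalPhysics.QuantumFieldTheory
open Literature.MathematicalPhysics.QuantumFieldTheory.LatticeForm (quo)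
open Literature.MathematicalPhysics.QuantumFieldTheory.Balaban1983to89
open Literature.MathematicalPhysics.QuantumFieldTheory.Balaban1983to89.Beta
open B4ContourShift (supNorm supNorm_nonneg)
open ExpKernelCalculus (Zl Zl_nonneg)
open AffineAveraging (Form0 Form1 Site box toSite)
open AffineReproduction (contourSumAdj)
open AveragingContours (blk)
open KernelSpecInstance (wΦ)
open B6BondElimination (unitVec unitVec_apply)
open KKTFluctuationKernel (delta1)
open BalabanCompositeJets (respStep)
open Summit.QuantumFields.BalabanUV.Beta.AxialProjectorBlockMean (bmGaugeAt)
open Summit.QuantumFields.BalabanUV.Beta.GAN24.RespStepBmDecompPsi (Psi)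
open Summit.QuantumFields.BalabanUV.Beta.GAN24.ContactGaugeStaircaseCauchy (exp_env_mono)
open Summit.QuantumFields.BalabanUV.Beta.GAN24.StaircaseFaceDensity (succ_pow_mul_pow_le_mul_pow)
open Summit.QuantumFields.BalabanUV.Beta.GAN24.ContactRefineBThree (abs_atomTip_refine_le abs_atomMid_refine_le abs_atomSite_refine_le)

namespace Summit.QuantumFields.BalabanUV.Beta.GAN24.ContactRefineBHolds

variable {Lc : ℕ} [NeZero Lc]

/-! ## §1 The five letter families at one rate -/

/-- NOT IN PRINT; OUR BOOKKEEPING.  **THE FIVE LETTER FAMILIES OF THE B-ATOMS AT ONE RATE** (`d = 3`, `2 ≤ Lc`): (N1), the tent bound, the leg refinement ε₁, the tent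
refinement ε₃ and the gauge SITE refinement εψ, all at the minimum `κ` of their suppliers' rates (envelopes are monotone in the rate). -/
theorem exists_common_refine_letters_three (hLc : 2 ≤ Lc) :
    ∃ κ C Φ₀ c₁ θ₁ A B θt c θ : ℝ, 0 < κ ∧ 0 ≤ C ∧ 0 ≤ Φ₀ ∧ 0 ≤ c₁ ∧ 0 ≤ θ₁ ∧ θ₁ < 1 ∧ 0 ≤ A ∧ 0 ≤ B ∧ 0 ≤ θt ∧ θt < 1 ∧
      0 ≤ c ∧ 0 ≤ θ ∧ θ < 1 ∧
      (∀ (m k : ℕ) (μ : Fin (3 + 1)) (z : Site (3 + 1)) (l'' : Fin (3 + 1)) (w' : Site (3 + 1)),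
        |respStep (d := 3) (Lc ^ m) (Lc ^ (m + k + 1)) μ z l'' w'| ≤
          C * ((Lc : ℝ) ^ (5 * (k + 1)))⁻¹ * Real.exp (-(κ * supNorm (quo (Lc ^ (k + 1)) w' - z)))) ∧
      (∀ (k : ℕ) (μ : Fin (3 + 1)) (z : Site (3 + 1)) (κ' : Fin (3 + 1)) (u : Site (3 + 1)),
        |contourSumAdj (Lc ^ (k + 1)) (fun κ' y => wΦ (N := Lc ^ (k + 1)) κ' μ (y - z)) κ' u|
          ≤ (Lc ^ (k + 1) : ℕ) * (Φ₀ * ((Lc : ℝ) ^ (8 * (k + 1)))⁻¹) * Real.exp κ * Real.exp (-(κ * supNorm (quo (Lc ^ (k + 1)) u - z)))) ∧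
      (∀ (k : ℕ) (μ : Fin (3 + 1)) (z : Site (3 + 1)) (l : Fin (3 + 1)) (v : Site (3 + 1)),
        |(Lc : ℝ) ^ (3 + 2) * respStep (d := 3) 1 (Lc ^ (k + 1 + 1)) μ z l v - respStep (d := 3) 1 (Lc ^ (k + 1)) μ z l (quo Lc v)|
          ≤ c₁ * θ₁ ^ k * (((Lc : ℝ) ^ (k + 1)) ^ (3 + 2))⁻¹ * Real.exp (-(κ * supNorm (quo (Lc ^ (k + 1 + 1)) v - z)))) ∧
      (∀ (k : ℕ) (μ : Fin (3 + 1)) (z : Site (3 + 1)) (κ' : Fin (3 + 1)) (x : Site (3 + 1)),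
        |(((Lc ^ (k + 1 + 1) : ℕ) : ℝ))⁻¹ *
              contourSumAdj (Lc ^ (k + 1 + 1))
                (fun κ'' y => (((Lc : ℝ) ^ (k + 1 + 1)) ^ (2 * (3 + 1))) * wΦ (N := Lc ^ (k + 1 + 1)) (d := 3) κ'' μ (y - z)) κ' x
            - (((Lc ^ (k + 1) : ℕ) : ℝ))⁻¹ *
              contourSumAdj (Lc ^ (k + 1))
                (fun κ'' y => (((Lc : ℝ) ^ (k + 1)) ^ (2 * (3 + 1))) * wΦ (N := Lc ^ (k + 1)) (d := 3) κ'' μ (y - z)) κ' (quo Lc x)|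
          ≤ (A * θt ^ k + B * (((Lc ^ (k + 1) : ℕ) : ℝ))⁻¹) * Real.exp (-(κ * supNorm (quo (Lc ^ (k + 1)) (quo Lc x) - z)))) ∧
      (∀ (rr : Fin (3 + 1) → ℕ), rr ∈ box (3 + 1) Lc → ∀ (k : ℕ) (μ : Fin (3 + 1)) (z : Site (3 + 1)) (u' : Site (3 + 1)),
        |(Psi (toSite rr) Lc 0 (k + 1) (delta1 μ z) u' - bmGaugeAt (toSite rr) (respStep (d := 3) 1 (Lc ^ (k + 2)) μ z) Lc u')
            - ((Lc : ℝ) ^ (3 + 1))⁻¹ *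
              (Psi (toSite rr) Lc 0 k (delta1 μ z) (blk Lc u') - bmGaugeAt (toSite rr) (respStep (d := 3) 1 (Lc ^ (k + 1)) μ z) Lc (blk Lc u'))|
          ≤ (16 * (Lc : ℝ) * c * θ ^ k * ((Lc : ℝ) ^ (5 * (k + 2)))⁻¹ * (Lc : ℝ) ^ (k + 1) + 8 * (Lc : ℝ) * C * ((Lc : ℝ) ^ (5 * (k + 2)))⁻¹) *
            Real.exp (-(κ * supNorm (quo (Lc ^ (k + 2)) u' - z)))) := by
  obtain ⟨κ₀, Ca, KE, Φ₀, hκ₀, hCa, -, hΦ₀, hN1, -, -, ht⟩ := ContactAssembly.exists_common_letters (Lc := Lc) hLc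
  obtain ⟨c₁, θ₁, κ₂, hc₁, hθ₁, hθ₁1, hκ₂, hdB⟩ := RespStepRefine.exists_respStep_refine (Lc := Lc) hLc
  obtain ⟨A, B, δ, θt, hδ, hθt, hθt1, hdt⟩ := ContactTentRefine.exists_tent_refine_three (Lc := Lc) hLc
  obtain ⟨cg, Cg, θg, κg, hcg, hCg, hθg, hθg1, hκg, hdl⟩ := ContactGaugeRefine.exists_gauge_refine_site_three (Lc := Lc) hLc
  -- the common rate and the merged (N1) constant
  set κ : ℝ := min (min κ₀ κ₂) (min δ κg) with hκdef
  have hκpos : 0 < κ := lt_min (lt_min hκ₀ hκ₂) (lt_min hδ hκg)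
  have hκ0 : κ ≤ κ₀ := (min_le_left _ _).trans (min_le_left _ _)
  have hκ2 : κ ≤ κ₂ := (min_le_left _ _).trans (min_le_right _ _)
  have hκδ : κ ≤ δ := (min_le_right _ _).trans (min_le_left _ _)
  have hκg' : κ ≤ κg := (min_le_right _ _).trans (min_le_right _ _)
  set C : ℝ := max Ca Cg with hCdef
  have hCaC : Ca ≤ C := le_max_left _ _
  have hCgC : Cg ≤ C := le_max_right _ _
  have hC : 0 ≤ C := hCa.trans hCaC
  have hL0 : (0 : ℝ) ≤ (Lc : ℝ) := Nat.cast_nonneg _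
  refine ⟨κ, C, Φ₀ * Real.exp κ₀, c₁, θ₁, |A|, |B|, θt, cg, θg, hκpos, hC, by positivity, hc₁, hθ₁, hθ₁1, abs_nonneg _, abs_nonneg _,
    hθt, hθt1, hcg, hθg, hθg1, fun m k μ z l'' w' => ?_, fun k μ z κ' u => ?_, fun k μ z l v => ?_, fun k μ z κ' x => ?_,
    fun rr hrr k μ z u' => ?_⟩
  · -- (N1) at the common rate, constant merged
    refine (hN1 m k μ z l'' w').trans ?_
    have hx := supNorm_nonneg (quo (Lc ^ (k + 1)) w' - z)
    have h1 := exp_env_mono hκ0 hx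
    have h2 : 0 ≤ ((Lc : ℝ) ^ (5 * (k + 1)))⁻¹ := by positivity
    calc Ca * ((Lc : ℝ) ^ (5 * (k + 1)))⁻¹ * Real.exp (-(κ₀ * supNorm (quo (Lc ^ (k + 1)) w' - z)))
        ≤ Ca * ((Lc : ℝ) ^ (5 * (k + 1)))⁻¹ * Real.exp (-(κ * supNorm (quo (Lc ^ (k + 1)) w' - z))) :=
          mul_le_mul_of_nonneg_left h1 (mul_nonneg hCa h2)
      _ ≤ C * ((Lc : ℝ) ^ (5 * (k + 1)))⁻¹ * Real.exp (-(κ * supNorm (quo (Lc ^ (k + 1)) w' - z))) := by gcongr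
  · -- the tent bound at the common rate: `Φ₀ ↦ Φ₀·e^{κ₀}`, `e^{κ₀} ↦ e^{κ} ≥ 1`
    refine (ht k μ z κ' u).trans ?_
    have hx := supNorm_nonneg (quo (Lc ^ (k + 1)) u - z)
    have h1 := exp_env_mono hκ0 hx
    have h2 : (1 : ℝ) ≤ Real.exp κ := Real.one_le_exp hκpos.le
    have h3 : 0 ≤ ((Lc ^ (k + 1) : ℕ) : ℝ) * (Φ₀ * ((Lc : ℝ) ^ (8 * (k + 1)))⁻¹) * Real.exp κ₀ := by positivity
    calc ((Lc ^ (k + 1) : ℕ) : ℝ) * (Φ₀ * ((Lc : ℝ) ^ (8 * (k + 1)))⁻¹) * Real.exp κ₀ * Real.exp (-(κ₀ * supNorm (quo (Lc ^ (k + 1)) u - z)))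
        ≤ ((Lc ^ (k + 1) : ℕ) : ℝ) * (Φ₀ * ((Lc : ℝ) ^ (8 * (k + 1)))⁻¹) * Real.exp κ₀ * Real.exp (-(κ * supNorm (quo (Lc ^ (k + 1)) u - z))) :=
          mul_le_mul_of_nonneg_left h1 h3
      _ = ((Lc ^ (k + 1) : ℕ) : ℝ) * (Φ₀ * Real.exp κ₀ * ((Lc : ℝ) ^ (8 * (k + 1)))⁻¹) * 1 * Real.exp (-(κ * supNorm (quo (Lc ^ (k + 1)) u - z))) := by
          ring
      _ ≤ ((Lc ^ (k + 1) : ℕ) : ℝ) * (Φ₀ * Real.exp κ₀ * ((Lc : ℝ) ^ (8 * (k + 1)))⁻¹) * Real.exp κ *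
            Real.exp (-(κ * supNorm (quo (Lc ^ (k + 1)) u - z))) := by gcongr
  · -- ε₁ at the common rate
    refine (hdB k μ z l v).trans ?_
    have hx := supNorm_nonneg (quo (Lc ^ (k + 1 + 1)) v - z)
    exact mul_le_mul_of_nonneg_left (exp_env_mono hκ2 hx) (by positivity)
  · -- ε₃ at the common rate, `A, B ↦ |A|, |B|`
    refine (hdt k μ z κ' x).trans ?_
    have hx := supNorm_nonneg (quo (Lc ^ (k + 1)) (quo Lc x) - z)
    have h1 := exp_env_mono hκδ hx
    have hN0 : 0 ≤ (((Lc ^ (k + 1) : ℕ) : ℝ))⁻¹ := by positivity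
    have hAB : A * θt ^ k + B * (((Lc ^ (k + 1) : ℕ) : ℝ))⁻¹ ≤ |A| * θt ^ k + |B| * (((Lc ^ (k + 1) : ℕ) : ℝ))⁻¹ :=
      add_le_add (mul_le_mul_of_nonneg_right (le_abs_self A) (pow_nonneg hθt k)) (mul_le_mul_of_nonneg_right (le_abs_self B) hN0)
    have hAB0 : 0 ≤ |A| * θt ^ k + |B| * (((Lc ^ (k + 1) : ℕ) : ℝ))⁻¹ := by positivity
    calc (A * θt ^ k + B * (((Lc ^ (k + 1) : ℕ) : ℝ))⁻¹) * Real.exp (-(δ * supNorm (quo (Lc ^ (k + 1)) (quo Lc x) - z)))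
        ≤ (|A| * θt ^ k + |B| * (((Lc ^ (k + 1) : ℕ) : ℝ))⁻¹) * Real.exp (-(δ * supNorm (quo (Lc ^ (k + 1)) (quo Lc x) - z))) :=
          mul_le_mul_of_nonneg_right hAB (Real.exp_pos _).le
      _ ≤ (|A| * θt ^ k + |B| * (((Lc ^ (k + 1) : ℕ) : ℝ))⁻¹) * Real.exp (-(κ * supNorm (quo (Lc ^ (k + 1)) (quo Lc x) - z))) :=
          mul_le_mul_of_nonneg_left h1 hAB0
  · -- εψ at the common rate, (N1) constant merged
    refine (hdl rr hrr k μ z u').trans ?_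
    have hx := supNorm_nonneg (quo (Lc ^ (k + 2)) u' - z)
    have h1 := exp_env_mono hκg' hx
    have hP0 : 0 ≤ ((Lc : ℝ) ^ (5 * (k + 2)))⁻¹ := by positivity
    have hsum : 16 * (Lc : ℝ) * cg * θg ^ k * ((Lc : ℝ) ^ (5 * (k + 2)))⁻¹ * (Lc : ℝ) ^ (k + 1) + 8 * (Lc : ℝ) * Cg * ((Lc : ℝ) ^ (5 * (k + 2)))⁻¹
        ≤ 16 * (Lc : ℝ) * cg * θg ^ k * ((Lc : ℝ) ^ (5 * (k + 2)))⁻¹ * (Lc : ℝ) ^ (k + 1) + 8 * (Lc : ℝ) * C * ((Lc : ℝ) ^ (5 * (k + 2)))⁻¹ := by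
      gcongr
    have hs0 : 0 ≤ 16 * (Lc : ℝ) * cg * θg ^ k * ((Lc : ℝ) ^ (5 * (k + 2)))⁻¹ * (Lc : ℝ) ^ (k + 1) + 8 * (Lc : ℝ) * C * ((Lc : ℝ) ^ (5 * (k + 2)))⁻¹ := by
      positivity
    exact (mul_le_mul_of_nonneg_right hsum (Real.exp_pos _).le).trans (mul_le_mul_of_nonneg_left h1 hs0)

/-! ## §2 One geometric majorant for the four small parameters and the log -/

omit [NeZero Lc] in
/-- [folklore] **ONE RATE `ϑ < 1` MAJORISES `θ₁^k, θt^k, θ^k, (Lc^{k+1})⁻¹` AND THE LOG `(k+1)·(Lc^{k+1})⁻¹`** (`2 ≤ Lc`; leaf-03's `succ_pow_mul_pow_le_mul_pow` with `p = 1`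
for the log, at the rate `(1 + Lc⁻¹)∕2 > Lc⁻¹`). -/
theorem exists_geometric_majorant (hLc : 2 ≤ Lc) {θ₁ θt θ : ℝ} (hθ₁ : 0 ≤ θ₁) (hθ₁1 : θ₁ < 1) (hθt : 0 ≤ θt) (hθt1 : θt < 1)
    (hθ : 0 ≤ θ) (hθ1 : θ < 1) :
    ∃ ϑ Kρ : ℝ, 0 ≤ ϑ ∧ ϑ < 1 ∧ 1 ≤ Kρ ∧ ∀ k : ℕ,
      θ₁ ^ k ≤ ϑ ^ k ∧ θt ^ k ≤ ϑ ^ k ∧ θ ^ k ≤ ϑ ^ k ∧ ((Lc : ℝ) ^ (k + 1))⁻¹ ≤ ϑ ^ k ∧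
        ((k : ℝ) + 1) * ((Lc : ℝ) ^ (k + 1))⁻¹ ≤ Kρ * ϑ ^ k := by
  have hL : (2 : ℝ) ≤ (Lc : ℝ) := by exact_mod_cast hLc
  have hLpos : (0 : ℝ) < (Lc : ℝ) := by linarith
  set ρ : ℝ := ((Lc : ℝ))⁻¹ with hρ
  have hρ0 : 0 ≤ ρ := by positivity
  have hρ1 : ρ ≤ 1 / 2 := by rw [hρ, inv_eq_one_div]; exact one_div_le_one_div_of_le (by norm_num) hL
  set ρ' : ℝ := (1 + ρ) / 2 with hρ'
  have hρρ' : ρ < ρ' := by rw [hρ']; linarith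
  have hρ'1 : ρ' < 1 := by rw [hρ']; linarith
  set ϑ : ℝ := max (max θ₁ θt) (max θ ρ') with hϑ
  have hϑ0 : 0 ≤ ϑ := hθ₁.trans ((le_max_left _ _).trans (le_max_left _ _))
  have hϑ1 : ϑ < 1 := max_lt (max_lt hθ₁1 hθt1) (max_lt hθ1 hρ'1)
  have h1 : θ₁ ≤ ϑ := (le_max_left _ _).trans (le_max_left _ _)
  have h2 : θt ≤ ϑ := (le_max_right _ _).trans (le_max_left _ _)
  have h3 : θ ≤ ϑ := (le_max_left _ _).trans (le_max_right _ _)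
  have h4 : ρ' ≤ ϑ := (le_max_right _ _).trans (le_max_right _ _)
  have hρϑ : ρ ≤ ϑ := hρρ'.le.trans h4
  -- the log: `(k+1)·ρ^k ≤ Kρ'·ρ'^k`
  obtain hlog := fun k : ℕ => succ_pow_mul_pow_le_mul_pow hρ0 hρρ' 1 k
  set Kρ : ℝ := max 1 (((Nat.factorial 1 : ℕ) : ℝ) / (1 - ρ / ρ') ^ (1 + 1)) with hKρ
  refine ⟨ϑ, Kρ, hϑ0, hϑ1, le_max_left _ _, fun k => ⟨pow_le_pow_left₀ hθ₁ h1 k, pow_le_pow_left₀ hθt h2 k, pow_le_pow_left₀ hθ h3 k, ?_, ?_⟩⟩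
  · -- `(Lc^{k+1})⁻¹ = ρ^{k+1} ≤ ρ^k ≤ ϑ^k`
    have e : ((Lc : ℝ) ^ (k + 1))⁻¹ = ρ ^ k * ρ := by rw [hρ, ← inv_pow, pow_succ]
    rw [e]
    calc ρ ^ k * ρ ≤ ρ ^ k * 1 := mul_le_mul_of_nonneg_left (hρ1.trans (by norm_num)) (pow_nonneg hρ0 k)
      _ = ρ ^ k := mul_one _
      _ ≤ ϑ ^ k := pow_le_pow_left₀ hρ0 hρϑ k
  · have e : ((Lc : ℝ) ^ (k + 1))⁻¹ = ρ ^ k * ρ := by rw [hρ, ← inv_pow, pow_succ]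
    rw [e]
    have hk := hlog k
    rw [pow_one] at hk
    have hK1 : ((Nat.factorial 1 : ℕ) : ℝ) / (1 - ρ / ρ') ^ (1 + 1) ≤ Kρ := le_max_right _ _
    have hKρ0 : 0 ≤ Kρ := zero_le_one.trans (le_max_left _ _)
    calc ((k : ℝ) + 1) * (ρ ^ k * ρ) = (((k : ℝ) + 1) * ρ ^ k) * ρ := by ring
      _ ≤ (((Nat.factorial 1 : ℕ) : ℝ) / (1 - ρ / ρ') ^ (1 + 1) * ρ' ^ k) * 1 :=
          mul_le_mul hk (hρ1.trans (by norm_num)) hρ0 (by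
            have : 0 ≤ ((k : ℝ) + 1) * ρ ^ k := by positivity
            exact this.trans hk)
      _ = ((Nat.factorial 1 : ℕ) : ℝ) / (1 - ρ / ρ') ^ (1 + 1) * ρ' ^ k := mul_one _
      _ ≤ Kρ * ϑ ^ k := mul_le_mul hK1 (pow_le_pow_left₀ (hρ0.trans hρρ'.le) h4 k) (pow_nonneg (hρ0.trans hρρ'.le) k) hKρ0

/-! ## §3 The three B-atom two-tower differences in closed geometric form -/

/-- NOT IN PRINT; OUR BOOKKEEPING.  **THE TIP B-ATOM OF THE CONTACT CELLS ACROSS TWO CONSECUTIVE TOWERS IS GEOMETRICALLY SMALL, UNCONDITIONALLY** (`d = 3`, `2 ≤ Lc`,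
every in-block root, every `k`, all cell data): `|N′^{12}·atomTip_{k+1} − N^{12}·atomTip_k| ≤ K·ϑ^k·Zl 4 (κ∕16)·e^{−(κ∕12)(‖u′−x′‖∞+‖z′−x′‖∞)}`, `ϑ < 1`. -/
theorem exists_atomTip_refine_three (hLc : 2 ≤ Lc) :
    ∃ κ K ϑ : ℝ, 0 < κ ∧ 0 ≤ K ∧ 0 ≤ ϑ ∧ ϑ < 1 ∧
      ∀ (rr : Fin (3 + 1) → ℕ), rr ∈ box (3 + 1) Lc →
        ∀ (k : ℕ) (κ' : Fin (3 + 1)) (u' : Site (3 + 1)) (α : Fin (3 + 1)) (x' : Site (3 + 1)) (β : Fin (3 + 1)) (z' : Site (3 + 1)),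
          |((Lc : ℝ) ^ (k + 2)) ^ 12 *
          (∑' x : Site (3 + 1), ∑ κ,
            (Psi (toSite rr) Lc 0 (k + 1) (delta1 α x') - bmGaugeAt (toSite rr) (respStep (d := 3) 1 (Lc ^ (k + 2)) α x') Lc) (x + unitVec κ)
              * respStep (d := 3) 1 (Lc ^ (k + 2)) κ' u' κ x
              * contourSumAdj (Lc ^ (k + 2)) (fun l y => wΦ (N := Lc ^ (k + 2)) (d := 3) l β (y - z')) κ x)
          - ((Lc : ℝ) ^ (k + 1)) ^ 12 *
          (∑' cc : Site (3 + 1), ∑ κ,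
            (Psi (toSite rr) Lc 0 k (delta1 α x') - bmGaugeAt (toSite rr) (respStep (d := 3) 1 (Lc ^ (k + 1)) α x') Lc) (cc + unitVec κ)
              * respStep (d := 3) 1 (Lc ^ (k + 1)) κ' u' κ cc
              * contourSumAdj (Lc ^ (k + 1)) (fun l y => wΦ (N := Lc ^ (k + 1)) (d := 3) l β (y - z')) κ cc)|
          ≤ K * ϑ ^ k * (Zl (3 + 1) (κ / (4 * ((((3 : ℕ) : ℝ)) + 1))) * Real.exp (-(κ / 12) * (supNorm (u' - x') + supNorm (z' - x')))) := by
  obtain ⟨κ, C, Φ₀, c₁, θ₁, A, B, θt, c, θ, hκ, hC, hΦ, hc₁, hθ₁, hθ₁1, hA, hB, hθt, hθt1, hc, hθ, hθ1, hN1, ht, hdB, hdt, hdl⟩ :=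
    exists_common_refine_letters_three (Lc := Lc) hLc
  obtain ⟨ϑ, Kρ, hϑ0, hϑ1, hKρ, hmaj⟩ := exists_geometric_majorant (Lc := Lc) hLc hθ₁ hθ₁1 hθt hθt1 hθ hθ1
  have hKρ0 : 0 ≤ Kρ := zero_le_one.trans hKρ
  have hL0 : (0 : ℝ) ≤ (Lc : ℝ) := Nat.cast_nonneg _
  set K : ℝ := ((((3 : ℕ) : ℝ)) + 1) *
      (Real.exp κ * ((16 * C) * (c₁ * 1) * (Φ₀ * Real.exp κ) + (16 * C) * C * (A * 1 + B * 1) + (16 * c * 1 + 8 * C * 1) * C * (Φ₀ * Real.exp κ))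
        + 2 * Real.exp κ * ((Kρ * 1) * (8 * (Lc : ℝ) * C)) * (C * (Φ₀ * Real.exp κ))) with hK
  refine ⟨κ, K, ϑ, hκ, by positivity, hϑ0, hϑ1, fun rr hrr k κ' u' α x' β z' => ?_⟩
  obtain ⟨m1, m2, m3, m4, m5⟩ := hmaj k
  have hbr : Real.exp κ * ((16 * C) * (c₁ * θ₁ ^ k) * (Φ₀ * Real.exp κ) + (16 * C) * C * (A * θt ^ k + B * ((Lc : ℝ) ^ (k + 1))⁻¹)
              + (16 * c * θ ^ k + 8 * C * ((Lc : ℝ) ^ (k + 1))⁻¹) * C * (Φ₀ * Real.exp κ))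
            + 2 * Real.exp κ * (((k : ℝ) + 1) * (8 * (Lc : ℝ) * C * ((Lc : ℝ) ^ (k + 1))⁻¹)) * (C * (Φ₀ * Real.exp κ))
      ≤ (Real.exp κ * ((16 * C) * (c₁ * 1) * (Φ₀ * Real.exp κ) + (16 * C) * C * (A * 1 + B * 1) + (16 * c * 1 + 8 * C * 1) * C * (Φ₀ * Real.exp κ))
          + 2 * Real.exp κ * ((Kρ * 1) * (8 * (Lc : ℝ) * C)) * (C * (Φ₀ * Real.exp κ))) * ϑ ^ k := by
    have eq : (Real.exp κ * ((16 * C) * (c₁ * 1) * (Φ₀ * Real.exp κ) + (16 * C) * C * (A * 1 + B * 1) + (16 * c * 1 + 8 * C * 1) * C * (Φ₀ * Real.exp κ))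
          + 2 * Real.exp κ * ((Kρ * 1) * (8 * (Lc : ℝ) * C)) * (C * (Φ₀ * Real.exp κ))) * ϑ ^ k
        = Real.exp κ * ((16 * C) * (c₁ * ϑ ^ k) * (Φ₀ * Real.exp κ) + (16 * C) * C * (A * ϑ ^ k + B * ϑ ^ k)
              + (16 * c * ϑ ^ k + 8 * C * ϑ ^ k) * C * (Φ₀ * Real.exp κ))
            + 2 * Real.exp κ * ((Kρ * ϑ ^ k) * (8 * (Lc : ℝ) * C)) * (C * (Φ₀ * Real.exp κ)) := by ring
    rw [eq, show ((k : ℝ) + 1) * (8 * (Lc : ℝ) * C * ((Lc : ℝ) ^ (k + 1))⁻¹) = (((k : ℝ) + 1) * ((Lc : ℝ) ^ (k + 1))⁻¹) * (8 * (Lc : ℝ) * C) by ring]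
    gcongr
  have h := abs_atomTip_refine_le hLc hrr hκ hC hΦ hc₁ hθ₁ hA hB hθt hc hθ hN1 ht hdB hdt (hdl rr hrr) k κ' u' α x' β z'
  refine h.trans ?_
  have hZ : 0 ≤ Zl (3 + 1) (κ / (4 * ((((3 : ℕ) : ℝ)) + 1))) * Real.exp (-(κ / 12) * (supNorm (u' - x') + supNorm (z' - x'))) := by
    have hc' : 0 < κ / (4 * ((((3 : ℕ) : ℝ)) + 1)) := by positivity
    exact mul_nonneg (Zl_nonneg hc') (Real.exp_pos _).le
  have h4 : (0 : ℝ) ≤ (((3 : ℕ) : ℝ)) + 1 := by positivity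
  rw [hK]
  calc _ ≤ ((((3 : ℕ) : ℝ)) + 1) * (_ * ϑ ^ k) * (Zl (3 + 1) (κ / (4 * ((((3 : ℕ) : ℝ)) + 1))) * Real.exp (-(κ / 12) * (supNorm (u' - x') + supNorm (z' - x')))) :=
        mul_le_mul_of_nonneg_right (mul_le_mul_of_nonneg_left hbr h4) hZ
    _ = _ := by ring

/-- NOT IN PRINT; OUR BOOKKEEPING.  **THE MIDPOINT B-ATOM, THE SAME.** -/
theorem exists_atomMid_refine_three (hLc : 2 ≤ Lc) :
    ∃ κ K ϑ : ℝ, 0 < κ ∧ 0 ≤ K ∧ 0 ≤ ϑ ∧ ϑ < 1 ∧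
      ∀ (rr : Fin (3 + 1) → ℕ), rr ∈ box (3 + 1) Lc →
        ∀ (k : ℕ) (κ' : Fin (3 + 1)) (u' : Site (3 + 1)) (α : Fin (3 + 1)) (x' : Site (3 + 1)) (β : Fin (3 + 1)) (z' : Site (3 + 1)),
          |((Lc : ℝ) ^ (k + 2)) ^ 12 *
          (∑' x : Site (3 + 1), ∑ κ,
            ((Psi (toSite rr) Lc 0 (k + 1) (delta1 α x') - bmGaugeAt (toSite rr) (respStep (d := 3) 1 (Lc ^ (k + 2)) α x') Lc) x + (Psi (toSite rr) Lc 0 (k + 1) (delta1 α x') - bmGaugeAt (toSite rr) (respStep (d := 3) 1 (Lc ^ (k + 2)) α x') Lc) (x + unitVec κ)) / 2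
              * respStep (d := 3) 1 (Lc ^ (k + 2)) κ' u' κ x
              * contourSumAdj (Lc ^ (k + 2)) (fun l y => wΦ (N := Lc ^ (k + 2)) (d := 3) l β (y - z')) κ x)
          - ((Lc : ℝ) ^ (k + 1)) ^ 12 *
          (∑' cc : Site (3 + 1), ∑ κ,
            ((Psi (toSite rr) Lc 0 k (delta1 α x') - bmGaugeAt (toSite rr) (respStep (d := 3) 1 (Lc ^ (k + 1)) α x') Lc) cc + (Psi (toSite rr) Lc 0 k (delta1 α x') - bmGaugeAt (toSite rr) (respStep (d := 3) 1 (Lc ^ (k + 1)) α x') Lc) (cc + unitVec κ)) / 2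
              * respStep (d := 3) 1 (Lc ^ (k + 1)) κ' u' κ cc
              * contourSumAdj (Lc ^ (k + 1)) (fun l y => wΦ (N := Lc ^ (k + 1)) (d := 3) l β (y - z')) κ cc)|
          ≤ K * ϑ ^ k * (Zl (3 + 1) (κ / (4 * ((((3 : ℕ) : ℝ)) + 1))) * Real.exp (-(κ / 12) * (supNorm (u' - x') + supNorm (z' - x')))) := by
  obtain ⟨κ, C, Φ₀, c₁, θ₁, A, B, θt, c, θ, hκ, hC, hΦ, hc₁, hθ₁, hθ₁1, hA, hB, hθt, hθt1, hc, hθ, hθ1, hN1, ht, hdB, hdt, hdl⟩ :=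
    exists_common_refine_letters_three (Lc := Lc) hLc
  obtain ⟨ϑ, Kρ, hϑ0, hϑ1, hKρ, hmaj⟩ := exists_geometric_majorant (Lc := Lc) hLc hθ₁ hθ₁1 hθt hθt1 hθ hθ1
  have hKρ0 : 0 ≤ Kρ := zero_le_one.trans hKρ
  have hL0 : (0 : ℝ) ≤ (Lc : ℝ) := Nat.cast_nonneg _
  set K : ℝ := ((((3 : ℕ) : ℝ)) + 1) *
      (Real.exp κ * ((16 * C) * (c₁ * 1) * (Φ₀ * Real.exp κ) + (16 * C) * C * (A * 1 + B * 1) + (16 * c * 1 + 8 * C * 1) * C * (Φ₀ * Real.exp κ))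
        + 2 * Real.exp κ * ((Kρ * 1) * (8 * (Lc : ℝ) * C)) * (C * (Φ₀ * Real.exp κ))) with hK
  refine ⟨κ, K, ϑ, hκ, by positivity, hϑ0, hϑ1, fun rr hrr k κ' u' α x' β z' => ?_⟩
  obtain ⟨m1, m2, m3, m4, m5⟩ := hmaj k
  have hbr : Real.exp κ * ((16 * C) * (c₁ * θ₁ ^ k) * (Φ₀ * Real.exp κ) + (16 * C) * C * (A * θt ^ k + B * ((Lc : ℝ) ^ (k + 1))⁻¹)
              + (16 * c * θ ^ k + 8 * C * ((Lc : ℝ) ^ (k + 1))⁻¹) * C * (Φ₀ * Real.exp κ))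
            + 2 * Real.exp κ * (((k : ℝ) + 1) * (8 * (Lc : ℝ) * C * ((Lc : ℝ) ^ (k + 1))⁻¹)) * (C * (Φ₀ * Real.exp κ))
      ≤ (Real.exp κ * ((16 * C) * (c₁ * 1) * (Φ₀ * Real.exp κ) + (16 * C) * C * (A * 1 + B * 1) + (16 * c * 1 + 8 * C * 1) * C * (Φ₀ * Real.exp κ))
          + 2 * Real.exp κ * ((Kρ * 1) * (8 * (Lc : ℝ) * C)) * (C * (Φ₀ * Real.exp κ))) * ϑ ^ k := by
    have eq : (Real.exp κ * ((16 * C) * (c₁ * 1) * (Φ₀ * Real.exp κ) + (16 * C) * C * (A * 1 + B * 1) + (16 * c * 1 + 8 * C * 1) * C * (Φ₀ * Real.exp κ))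
          + 2 * Real.exp κ * ((Kρ * 1) * (8 * (Lc : ℝ) * C)) * (C * (Φ₀ * Real.exp κ))) * ϑ ^ k
        = Real.exp κ * ((16 * C) * (c₁ * ϑ ^ k) * (Φ₀ * Real.exp κ) + (16 * C) * C * (A * ϑ ^ k + B * ϑ ^ k)
              + (16 * c * ϑ ^ k + 8 * C * ϑ ^ k) * C * (Φ₀ * Real.exp κ))
            + 2 * Real.exp κ * ((Kρ * ϑ ^ k) * (8 * (Lc : ℝ) * C)) * (C * (Φ₀ * Real.exp κ)) := by ring
    rw [eq, show ((k : ℝ) + 1) * (8 * (Lc : ℝ) * C * ((Lc : ℝ) ^ (k + 1))⁻¹) = (((k : ℝ) + 1) * ((Lc : ℝ) ^ (k + 1))⁻¹) * (8 * (Lc : ℝ) * C) by ring]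
    gcongr
  have h := abs_atomMid_refine_le hLc hrr hκ hC hΦ hc₁ hθ₁ hA hB hθt hc hθ hN1 ht hdB hdt (hdl rr hrr) k κ' u' α x' β z'
  refine h.trans ?_
  have hZ : 0 ≤ Zl (3 + 1) (κ / (4 * ((((3 : ℕ) : ℝ)) + 1))) * Real.exp (-(κ / 12) * (supNorm (u' - x') + supNorm (z' - x'))) := by
    have hc' : 0 < κ / (4 * ((((3 : ℕ) : ℝ)) + 1)) := by positivity
    exact mul_nonneg (Zl_nonneg hc') (Real.exp_pos _).le
  have h4 : (0 : ℝ) ≤ (((3 : ℕ) : ℝ)) + 1 := by positivity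
  rw [hK]
  calc _ ≤ ((((3 : ℕ) : ℝ)) + 1) * (_ * ϑ ^ k) * (Zl (3 + 1) (κ / (4 * ((((3 : ℕ) : ℝ)) + 1))) * Real.exp (-(κ / 12) * (supNorm (u' - x') + supNorm (z' - x')))) :=
        mul_le_mul_of_nonneg_right (mul_le_mul_of_nonneg_left hbr h4) hZ
    _ = _ := by ring

/-- NOT IN PRINT; OUR BOOKKEEPING.  **THE SITE B-ATOM, THE SAME** (no weight wobble, no realignment). -/
theorem exists_atomSite_refine_three (hLc : 2 ≤ Lc) :
    ∃ κ K ϑ : ℝ, 0 < κ ∧ 0 ≤ K ∧ 0 ≤ ϑ ∧ ϑ < 1 ∧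
      ∀ (rr : Fin (3 + 1) → ℕ), rr ∈ box (3 + 1) Lc →
        ∀ (k : ℕ) (κ' : Fin (3 + 1)) (u' : Site (3 + 1)) (α : Fin (3 + 1)) (x' : Site (3 + 1)) (β : Fin (3 + 1)) (z' : Site (3 + 1)),
          |((Lc : ℝ) ^ (k + 2)) ^ 12 *
          (∑' x : Site (3 + 1), ∑ κ,
            (Psi (toSite rr) Lc 0 (k + 1) (delta1 α x') - bmGaugeAt (toSite rr) (respStep (d := 3) 1 (Lc ^ (k + 2)) α x') Lc) x
              * respStep (d := 3) 1 (Lc ^ (k + 2)) κ' u' κ x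
              * contourSumAdj (Lc ^ (k + 2)) (fun l y => wΦ (N := Lc ^ (k + 2)) (d := 3) l β (y - z')) κ x)
          - ((Lc : ℝ) ^ (k + 1)) ^ 12 *
          (∑' cc : Site (3 + 1), ∑ κ,
            (Psi (toSite rr) Lc 0 k (delta1 α x') - bmGaugeAt (toSite rr) (respStep (d := 3) 1 (Lc ^ (k + 1)) α x') Lc) cc
              * respStep (d := 3) 1 (Lc ^ (k + 1)) κ' u' κ cc
              * contourSumAdj (Lc ^ (k + 1)) (fun l y => wΦ (N := Lc ^ (k + 1)) (d := 3) l β (y - z')) κ cc)|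
          ≤ K * ϑ ^ k * (Zl (3 + 1) (κ / (4 * ((((3 : ℕ) : ℝ)) + 1))) * Real.exp (-(κ / 12) * (supNorm (u' - x') + supNorm (z' - x')))) := by
  obtain ⟨κ, C, Φ₀, c₁, θ₁, A, B, θt, c, θ, hκ, hC, hΦ, hc₁, hθ₁, hθ₁1, hA, hB, hθt, hθt1, hc, hθ, hθ1, hN1, ht, hdB, hdt, hdl⟩ :=
    exists_common_refine_letters_three (Lc := Lc) hLc
  obtain ⟨ϑ, Kρ, hϑ0, hϑ1, hKρ, hmaj⟩ := exists_geometric_majorant (Lc := Lc) hLc hθ₁ hθ₁1 hθt hθt1 hθ hθ1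
  have hKρ0 : 0 ≤ Kρ := zero_le_one.trans hKρ
  have hL0 : (0 : ℝ) ≤ (Lc : ℝ) := Nat.cast_nonneg _
  set K : ℝ := ((((3 : ℕ) : ℝ)) + 1) *
      ((16 * C) * (c₁ * 1) * (Φ₀ * Real.exp κ) + (16 * C) * C * (A * 1 + B * 1) + (16 * c * 1 + 8 * C * 1) * C * (Φ₀ * Real.exp κ)) with hK
  refine ⟨κ, K, ϑ, hκ, by positivity, hϑ0, hϑ1, fun rr hrr k κ' u' α x' β z' => ?_⟩
  obtain ⟨m1, m2, m3, m4, m5⟩ := hmaj k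
  have hbr : (16 * C) * (c₁ * θ₁ ^ k) * (Φ₀ * Real.exp κ) + (16 * C) * C * (A * θt ^ k + B * ((Lc : ℝ) ^ (k + 1))⁻¹)
              + (16 * c * θ ^ k + 8 * C * ((Lc : ℝ) ^ (k + 1))⁻¹) * C * (Φ₀ * Real.exp κ)
      ≤ ((16 * C) * (c₁ * 1) * (Φ₀ * Real.exp κ) + (16 * C) * C * (A * 1 + B * 1) + (16 * c * 1 + 8 * C * 1) * C * (Φ₀ * Real.exp κ)) * ϑ ^ k := by
    have eq : ((16 * C) * (c₁ * 1) * (Φ₀ * Real.exp κ) + (16 * C) * C * (A * 1 + B * 1) + (16 * c * 1 + 8 * C * 1) * C * (Φ₀ * Real.exp κ)) * ϑ ^ k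
        = (16 * C) * (c₁ * ϑ ^ k) * (Φ₀ * Real.exp κ) + (16 * C) * C * (A * ϑ ^ k + B * ϑ ^ k)
              + (16 * c * ϑ ^ k + 8 * C * ϑ ^ k) * C * (Φ₀ * Real.exp κ) := by ring
    rw [eq]
    gcongr
  have h := abs_atomSite_refine_le hLc hrr hκ hC hΦ hc₁ hθ₁ hA hB hθt hc hθ hN1 ht hdB hdt (hdl rr hrr) k κ' u' α x' β z'
  refine h.trans ?_
  have hZ : 0 ≤ Zl (3 + 1) (κ / (4 * ((((3 : ℕ) : ℝ)) + 1))) * Real.exp (-(κ / 12) * (supNorm (u' - x') + supNorm (z' - x'))) := by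
    have hc' : 0 < κ / (4 * ((((3 : ℕ) : ℝ)) + 1)) := by positivity
    exact mul_nonneg (Zl_nonneg hc') (Real.exp_pos _).le
  have h4 : (0 : ℝ) ≤ (((3 : ℕ) : ℝ)) + 1 := by positivity
  rw [hK]
  calc _ ≤ ((((3 : ℕ) : ℝ)) + 1) * (_ * ϑ ^ k) * (Zl (3 + 1) (κ / (4 * ((((3 : ℕ) : ℝ)) + 1))) * Real.exp (-(κ / 12) * (supNorm (u' - x') + supNorm (z' - x')))) :=
        mul_le_mul_of_nonneg_right (mul_le_mul_of_nonneg_left hbr h4) hZ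
    _ = _ := by ring

end Summit.QuantumFields.BalabanUV.Beta.GAN24.ContactRefineBHolds

end
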